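import Summits.Ventures.PercRepro.C041ZoneZFReach
import Summits.Ventures.PercRepro.C041ZoneZSteps

/-!
# THEOREM Z′ — the three steps with forced edges (p6, gen 27; C-041.md §13)

Setting of `C041ZoneZFReach`.  The three maps `psiF` / `chiF` / `phiF` (duals / complement outside `P`, `C ∪ P`,
`D ∪ P` on the free edges), their involution property (`psiF_psiF`, `chiF_chiF`, `phiF_phiF`), `Γ` preserved
(`gam_dualF`, `gam_flipOutF`), and the membership transfers `psiF_mem` (`Κ → K2`), `chiF_mem` (`K2 → P2`), `phiF_mem`
(`P2 → Ρ′`) — the proofs of `C041ZoneZSteps` with the free / forced case distinction at every edge and the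
blue-isolated region kept out of every blue path from a marked vertex (`not_mem_of_blueAdj_chiF`, `Bl_chiF_subset`,
`D_chiF_subset`, `disjoint_CmixF_D`, `reachIn_phiF_subset_CmixF`).
-/

namespace PercRepro

namespace ZoneZ

namespace FZone

open ZoneData

variable {V E T₁ T₂ : Type*} (F : FZone V E T₁ T₂) (Q A : Set V)

/-! ## The three maps -/

/-- STEP 2: the dual outside the protected sub-zones. -/
noncomputable def psiF (σ : State E T₁ T₂) : State E T₁ T₂ := F.dualF (F.P Q σ) σ

/-- STEP 3: the dual outside the mixed reach of the anchors and the protected sub-zones. -/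
noncomputable def chiF (σ : State E T₁ T₂) : State E T₁ T₂ := F.dualF (F.CmixF Q A σ ∪ F.P Q σ) σ

/-- STEP 1: the complement outside the deleted vertices and the protected sub-zones. -/
noncomputable def phiF (σ : State E T₁ T₂) : State E T₁ T₂ := F.flipOutF (F.D σ ∪ F.P Q σ) σ

/-- `psiF` preserves `P`. -/
theorem P_psiF (σ : State E T₁ T₂) : F.P Q (F.psiF Q σ) = F.P Q σ := F.P_dualF_eq Q _ σ (le_refl _)

/-- `psiF` is an involution. -/
theorem psiF_psiF (σ : State E T₁ T₂) : F.psiF Q (F.psiF Q σ) = σ := by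
  unfold psiF
  rw [F.P_dualF_eq Q _ σ (le_refl _), F.dualF_dualF]

/-- `chiF` preserves `P`. -/
theorem P_chiF (σ : State E T₁ T₂) : F.P Q (F.chiF Q A σ) = F.P Q σ :=
  F.P_dualF_eq Q _ σ Set.subset_union_right

/-- `chiF` preserves `C`. -/
theorem CmixF_chiF (σ : State E T₁ T₂) : F.CmixF Q A (F.chiF Q A σ) = F.CmixF Q A σ :=
  F.CmixF_dualF_eq Q A _ σ Set.subset_union_right Set.subset_union_left

/-- `chiF` is an involution. -/
theorem chiF_chiF (σ : State E T₁ T₂) : F.chiF Q A (F.chiF Q A σ) = σ := by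
  have h1 := F.P_chiF Q A σ
  have h2 := F.CmixF_chiF Q A σ
  unfold chiF at h1 h2 ⊢
  rw [h1, h2, F.dualF_dualF]

/-- `phiF` preserves `P`. -/
theorem P_phiF (σ : State E T₁ T₂) : F.P Q (F.phiF Q σ) = F.P Q σ :=
  F.P_flipOutF_eq Q _ σ Set.subset_union_right

/-- `phiF` preserves `D`. -/
theorem D_phiF (σ : State E T₁ T₂) : F.D (F.phiF Q σ) = F.D σ := F.D_flipOutF_eq _ σ Set.subset_union_left

/-- `phiF` is an involution. -/
theorem phiF_phiF (σ : State E T₁ T₂) : F.phiF Q (F.phiF Q σ) = σ := by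
  have h1 := F.P_phiF Q σ
  have h2 := F.D_phiF Q σ
  unfold phiF at h1 h2 ⊢
  rw [h1, h2, F.flipOutF_flipOutF]

/-- `psiF` is injective. -/
theorem psiF_injective : Function.Injective (F.psiF Q) := injective_of_involutive _ (F.psiF_psiF Q)

/-- `chiF` is injective. -/
theorem chiF_injective : Function.Injective (F.chiF Q A) := injective_of_involutive _ (F.chiF_chiF Q A)

/-- `phiF` is injective. -/
theorem phiF_injective : Function.Injective (F.phiF Q) := injective_of_involutive _ (F.phiF_phiF Q)

/-- A dual outside a set containing `P` preserves `Γ`. -/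
theorem gam_dualF (X : Set V) (σ : State E T₁ T₂) (hX : F.P Q σ ⊆ X) (hΓ : F.Gam Q σ) :
    F.Gam Q (F.dualF X σ) := by
  unfold ZoneData.Gam
  rw [F.P_dualF_eq Q X σ hX, F.M_dualF, Set.disjoint_left]
  intro v hvP hv
  refine Set.disjoint_left.1 hΓ hvP ?_
  rcases hv with hv | hv
  · exact Or.inl ((F.mem_Bl_dualF_of_mem X σ (hX hvP)).1 hv)
  · exact Or.inr hv

/-- A complement outside a set containing `P` preserves `Γ`. -/
theorem gam_flipOutF (X : Set V) (σ : State E T₁ T₂) (hX : F.P Q σ ⊆ X) (hΓ : F.Gam Q σ) :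
    F.Gam Q (F.flipOutF X σ) := by
  unfold ZoneData.Gam
  rw [F.P_flipOutF_eq Q X σ hX, F.M_flipOutF, F.Bl_flipOutF]
  exact hΓ

/-! ## STEP 2 -/

/-- The mixed reach of the anchors in `psiF σ` is the red reach of the anchors in `σ`. -/
theorem CmixF_psiF (σ : State E T₁ T₂) : F.CmixF Q A (F.psiF Q σ) = F.K A σ := by
  unfold CmixF ZoneData.K
  rw [F.P_psiF Q σ]
  exact reach_congr (F.mixedAdjF_dualF_iff (F.P Q σ) σ) A

/-- The free red reach outside `P` of the red-marked vertices of `psiF σ` lies in the deleted set of `σ`. -/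
theorem reachIn_psiF_subset_D (σ : State E T₁ T₂) :
    reachIn (F.FreeRedAdj (F.psiF Q σ)) (F.P Q (F.psiF Q σ))ᶜ (F.Blt (F.psiF Q σ)) ⊆ F.D σ := by
  rw [F.P_psiF Q σ]
  unfold reachIn ZoneData.D
  apply reach_mono
  · rintro u v ⟨h, hu, hv⟩
    exact F.blueAdj_of_freeBlueAdj ((F.freeRedAdj_dualF_iff (F.P Q σ) σ hu hv).1 h)
  · rintro v ⟨hv, hvP⟩
    exact (F.mem_Blt_dualF_of_not_mem (F.P Q σ) σ hvP).1 hv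

/-- **STEP 2**: `psiF` carries `{Forced ∧ adm ∧ blueK ∧ Γ}` into `K2`. -/
theorem psiF_mem (σ : State E T₁ T₂) (hF : F.Forced σ) (hadm : F.adm σ) (hK : F.blueK A σ) (hΓ : F.Gam Q σ) :
    F.Forced (F.psiF Q σ) ∧
      Disjoint (F.M (F.psiF Q σ))
        (reachIn (F.FreeRedAdj (F.psiF Q σ)) (F.P Q (F.psiF Q σ))ᶜ (F.Blt (F.psiF Q σ))) ∧
      Disjoint (F.CmixF Q A (F.psiF Q σ))
        (F.Bl (F.psiF Q σ) ∪ F.Mt (F.psiF Q σ) ∪ (F.Blt (F.psiF Q σ) ∩ F.P Q (F.psiF Q σ))) ∧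
      F.Gam Q (F.psiF Q σ) := by
  refine ⟨F.forced_dualF _ hF, ?_, ?_, F.gam_dualF Q _ σ (le_refl _) hΓ⟩
  · have hM : F.M (F.psiF Q σ) = F.M σ := F.M_dualF _ σ
    rw [hM]
    exact Set.disjoint_of_subset_right (F.reachIn_psiF_subset_D Q σ) hadm
  · rw [F.CmixF_psiF Q A σ, F.P_psiF Q σ]
    have hMt : F.Mt (F.psiF Q σ) = F.Mt σ := F.Mt_dualF _ σ
    rw [hMt, Set.disjoint_left]
    intro v hvK hv
    rcases hv with (hv | hv) | ⟨hv, hvP⟩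
    · by_cases hvP : v ∈ F.P Q σ
      · exact Set.disjoint_left.1 hΓ hvP (Or.inl ((F.mem_Bl_dualF_of_mem _ σ hvP).1 hv))
      · exact Set.disjoint_left.1 hK hvK (Or.inl ((F.mem_Bl_dualF_of_not_mem _ σ hvP).1 hv))
    · exact Set.disjoint_left.1 hK hvK (Or.inr hv)
    · exact Set.disjoint_left.1 hK hvK (Or.inl ((F.mem_Blt_dualF_of_mem _ σ hvP).1 hv))

/-! ## STEP 3 -/

/-- The complement of `C ∪ P ∪ iso` is closed under the blue adjacency of `chiF σ`. -/
theorem not_mem_of_blueAdj_chiF {σ : State E T₁ T₂} (hF : F.Forced σ) {u v : V}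
    (hu : u ∉ F.CmixF Q A σ ∪ F.P Q σ ∪ F.iso) (h : F.BlueAdj (F.chiF Q A σ) u v) :
    v ∉ F.CmixF Q A σ ∪ F.P Q σ ∪ F.iso := by
  have huI : u ∉ F.iso := fun h' => hu (Or.inr h')
  have huP : u ∉ F.P Q σ := fun h' => hu (Or.inl (Or.inr h'))
  have huC : u ∉ F.CmixF Q A σ := fun h' => hu (Or.inl (Or.inl h'))
  have hvI : v ∉ F.iso := F.not_mem_iso_of_blueAdj (F.forced_dualF _ hF) huI h
  rintro (hv | hv)
  · obtain ⟨e, hj, hc⟩ := h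
    have ht : F.Touches (F.CmixF Q A σ ∪ F.P Q σ) e := F.touches_of_joins_left hj.symm hv
    rw [chiF, F.dualF_fst_of_touches _ σ ht] at hc
    have hfree : F.free e := F.free_of_blue_of_end_not_mem hF hc (by
      rcases hj with ⟨h1, _⟩ | ⟨_, h2⟩
      · exact Or.inl (h1 ▸ huI)
      · exact Or.inr (h2 ▸ huI))
    have hblue : F.FreeBlueAdj σ v u := ⟨e, hj.symm, hfree, hc⟩
    rcases hv with hvC | hvP
    · by_cases hvP : v ∈ F.P Q σ
      · exact huP (F.blue_closed_P Q σ v u hvP (F.blueAdj_of_freeBlueAdj hblue))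
      · exact huC (reach_tail hvC (F.mixedAdjF_of_freeBlueAdj hblue hvP huP))
    · exact huP (F.blue_closed_P Q σ v u hvP (F.blueAdj_of_freeBlueAdj hblue))
  · exact hvI hv

/-- The blockers of `chiF σ` lie outside `C ∪ P ∪ iso` and are red-marked in `σ`. -/
theorem Bl_chiF_subset (σ : State E T₁ T₂) (hC : Disjoint (F.CmixF Q A σ) (F.Bl σ)) (hΓ : F.Gam Q σ) :
    F.Bl (F.chiF Q A σ) ⊆ F.Blt σ ∩ (F.CmixF Q A σ ∪ F.P Q σ ∪ F.iso)ᶜ := by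
  intro v hv
  have hvI : v ∉ F.iso := F.Bl_subset_iso_compl _ hv
  have hvX : v ∉ F.CmixF Q A σ ∪ F.P Q σ := by
    intro hvX
    have hvBl : v ∈ F.Bl σ := (F.mem_Bl_dualF_of_mem _ σ hvX).1 hv
    rcases hvX with hvC | hvP
    · exact Set.disjoint_left.1 hC hvC hvBl
    · exact Set.disjoint_left.1 hΓ hvP (Or.inl hvBl)
  refine ⟨(F.mem_Bl_dualF_of_not_mem _ σ hvX).1 hv, ?_⟩
  rintro (h | h)
  · exact hvX h
  · exact hvI h

/-- The deleted set of `chiF σ` lies in the free red reach outside `P` of the red-marked vertices of `σ`. -/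
theorem D_chiF_subset {σ : State E T₁ T₂} (hF : F.Forced σ) (hC : Disjoint (F.CmixF Q A σ) (F.Bl σ))
    (hΓ : F.Gam Q σ) : F.D (F.chiF Q A σ) ⊆ reachIn (F.FreeRedAdj σ) (F.P Q σ)ᶜ (F.Blt σ) := by
  have hBl := F.Bl_chiF_subset Q A σ hC hΓ
  have h1 : F.D (F.chiF Q A σ) ⊆
      reachIn (F.BlueAdj (F.chiF Q A σ)) (F.CmixF Q A σ ∪ F.P Q σ ∪ F.iso)ᶜ (F.Bl (F.chiF Q A σ)) :=
    reach_subset_reachIn_of_closed (fun v hv => (hBl hv).2) fun u v hu h => F.not_mem_of_blueAdj_chiF Q A hF hu h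
  have h2 : reachIn (F.BlueAdj (F.chiF Q A σ)) (F.CmixF Q A σ ∪ F.P Q σ ∪ F.iso)ᶜ (F.Bl (F.chiF Q A σ)) ⊆
      reachIn (F.FreeRedAdj σ) (F.CmixF Q A σ ∪ F.P Q σ ∪ F.iso)ᶜ (F.Blt σ) := by
    apply reach_mono
    · rintro u v ⟨⟨e, hj, hc⟩, hu, hv⟩
      have huI : u ∉ F.iso := fun h' => hu (Or.inr h')
      have hfree : F.free e := F.free_of_blue_of_end_not_mem (F.forced_dualF _ hF) hc (by
        rcases hj with ⟨h1, _⟩ | ⟨_, h2⟩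
        · exact Or.inl (h1 ▸ huI)
        · exact Or.inr (h2 ▸ huI))
      have huX : u ∉ F.CmixF Q A σ ∪ F.P Q σ := fun h' => hu (Or.inl h')
      have hvX : v ∉ F.CmixF Q A σ ∪ F.P Q σ := fun h' => hv (Or.inl h')
      exact ⟨F.freeRedAdj_of_blueAdj_dualF _ σ huX hvX hj hfree hc, hu, hv⟩
    · rintro v ⟨hv, hvX⟩
      exact ⟨(hBl hv).1, hvX⟩
  have h3 : reachIn (F.FreeRedAdj σ) (F.CmixF Q A σ ∪ F.P Q σ ∪ F.iso)ᶜ (F.Blt σ) ⊆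
      reachIn (F.FreeRedAdj σ) (F.P Q σ)ᶜ (F.Blt σ) :=
    reachIn_mono (Set.compl_subset_compl.2 (Set.subset_union_right.trans Set.subset_union_left)) le_rfl
  exact h1.trans (h2.trans h3)

/-- **STEP 3**: `chiF` carries `K2` into `P2`. -/
theorem chiF_mem (σ : State E T₁ T₂) (hF : F.Forced σ)
    (h1 : Disjoint (F.M σ) (reachIn (F.FreeRedAdj σ) (F.P Q σ)ᶜ (F.Blt σ)))
    (h2 : Disjoint (F.CmixF Q A σ) (F.Bl σ ∪ F.Mt σ ∪ (F.Blt σ ∩ F.P Q σ))) (hΓ : F.Gam Q σ) :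
    F.Forced (F.chiF Q A σ) ∧ F.adm (F.chiF Q A σ) ∧
      Disjoint (F.CmixF Q A (F.chiF Q A σ)) (F.Bl (F.chiF Q A σ) ∪ F.Mt (F.chiF Q A σ)) ∧
      F.Gam Q (F.chiF Q A σ) := by
  have hC : Disjoint (F.CmixF Q A σ) (F.Bl σ) :=
    Set.disjoint_of_subset_right (Set.subset_union_left.trans Set.subset_union_left) h2
  refine ⟨F.forced_dualF _ hF, ?_, ?_, F.gam_dualF Q _ σ Set.subset_union_right hΓ⟩
  · unfold ZoneData.adm
    have hM : F.M (F.chiF Q A σ) = F.M σ := F.M_dualF _ σ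
    rw [hM]
    exact Set.disjoint_of_subset_right (F.D_chiF_subset Q A hF hC hΓ) h1
  · rw [F.CmixF_chiF Q A σ]
    have hMt : F.Mt (F.chiF Q A σ) = F.Mt σ := F.Mt_dualF _ σ
    rw [hMt, Set.disjoint_left]
    intro v hvC hv
    rcases hv with hv | hv
    · exact Set.disjoint_left.1 h2 hvC (Or.inl (Or.inl ((F.mem_Bl_dualF_of_mem _ σ (Or.inl hvC)).1 hv)))
    · exact Set.disjoint_left.1 h2 hvC (Or.inl (Or.inr hv))

/-! ## STEP 1 -/

/-- When the mixed reach of the anchors misses the blockers it misses the deleted vertices. -/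
theorem disjoint_CmixF_D {σ : State E T₁ T₂} (hF : F.Forced σ) (hC : Disjoint (F.CmixF Q A σ) (F.Bl σ))
    (hΓ : F.Gam Q σ) : Disjoint (F.CmixF Q A σ) (F.D σ) := by
  rw [Set.disjoint_left]
  intro v hvC hvD
  have hPD := F.disjoint_P_D Q σ hΓ
  obtain ⟨w, hw, hwv⟩ := exists_mem_reach_of_mem_reach (F.adj_symm _ σ) hvD
  have hsub : reach (F.BlueAdj σ) {v} ⊆ F.CmixF Q A σ ∩ (F.P Q σ)ᶜ ∩ F.isoᶜ := by
    apply reach_subset_of_closed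
    · intro x hx
      rw [Set.mem_singleton_iff] at hx
      subst hx
      exact ⟨⟨hvC, fun hvP => Set.disjoint_left.1 hPD hvP hvD⟩, F.D_subset_iso_compl hF hvD⟩
    · rintro x y ⟨⟨hxC, hxP⟩, hxI⟩ h
      have hyP : y ∉ F.P Q σ := F.not_mem_P_of_blueAdj Q σ hxP h
      have hyI : y ∉ F.iso := F.not_mem_iso_of_blueAdj hF hxI h
      exact ⟨⟨reach_tail hxC (F.mixedAdjF_of_freeBlueAdj (F.freeBlueAdj_of_blueAdj hF hxI h) hxP hyP), hyP⟩,
        hyI⟩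
  exact Set.disjoint_left.1 hC (hsub hwv).1.1 hw

/-- The red reach of `phiF σ` inside the non-deleted vertices lies in the mixed reach `C` of `σ`. -/
theorem reachIn_phiF_subset_CmixF (σ : State E T₁ T₂) :
    reachIn (F.RedAdj (F.phiF Q σ)) (F.D (F.phiF Q σ))ᶜ A ⊆ F.CmixF Q A σ := by
  rw [F.D_phiF Q σ]
  apply reach_subset_of_closed
  · exact Set.inter_subset_left.trans subset_reach
  · rintro u v huC ⟨⟨e, hj, hc⟩, hu, hv⟩
    by_cases hf : F.free e
    · by_cases ht : F.Touches (F.P Q σ) e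
      · rw [phiF, F.flipOutF_fst_of_touches _ σ (F.touches_mono Set.subset_union_right ht)] at hc
        exact reach_tail huC ⟨e, hj, Or.inr ⟨Or.inr ht, hc⟩⟩
      · have ht' : ¬ F.Touches (F.D σ ∪ F.P Q σ) e := by
          rintro (h | h) <;> rcases h with h | h
          · exact (F.not_touches_of_joins hj hu hv) (Or.inl h)
          · exact ht (Or.inl h)
          · exact (F.not_touches_of_joins hj hu hv) (Or.inr h)
          · exact ht (Or.inr h)
        rw [phiF, F.flipOutF_fst_of_free _ σ hf ht'] at hc
        have hblue : σ.1 e = false := by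
          cases h : σ.1 e
          · rfl
          · rw [h] at hc
            exact absurd hc (by decide)
        exact reach_tail huC ⟨e, hj, Or.inl ⟨hf, ht, hblue⟩⟩
    · rw [phiF, F.flipOutF_fst_of_not_free _ σ hf] at hc
      exact reach_tail huC ⟨e, hj, Or.inr ⟨Or.inl hf, hc⟩⟩

/-- **STEP 1**: `phiF` carries `P2` into `{Forced ∧ adm ∧ ¬anchorDel ∧ reach2 ∧ Γ}`. -/
theorem phiF_mem (σ : State E T₁ T₂) (hF : F.Forced σ) (hadm : F.adm σ)
    (hC : Disjoint (F.CmixF Q A σ) (F.Bl σ ∪ F.Mt σ)) (hΓ : F.Gam Q σ) :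
    F.Forced (F.phiF Q σ) ∧ F.adm (F.phiF Q σ) ∧ ¬ F.anchorDel A (F.phiF Q σ) ∧ F.reach2 A (F.phiF Q σ) ∧
      F.Gam Q (F.phiF Q σ) := by
  have hCD : Disjoint (F.CmixF Q A σ) (F.D σ) :=
    F.disjoint_CmixF_D Q A hF (Set.disjoint_of_subset_right Set.subset_union_left hC) hΓ
  refine ⟨F.forced_flipOutF _ hF, ?_, ?_, ?_, F.gam_flipOutF Q _ σ Set.subset_union_right hΓ⟩
  · unfold ZoneData.adm
    rw [F.D_phiF Q σ]
    exact hadm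
  · unfold ZoneData.anchorDel
    rw [F.D_phiF Q σ]
    rintro ⟨v, hvA, hvD⟩
    exact Set.disjoint_left.1 hCD (subset_reach hvA) hvD
  · unfold ZoneData.reach2 ZoneData.REACH
    have hMt : F.Mt (F.phiF Q σ) = F.Mt σ := F.Mt_flipOutF _ σ
    rw [hMt]
    exact Set.disjoint_of_subset_left (F.reachIn_phiF_subset_CmixF Q A σ)
      (Set.disjoint_of_subset_right Set.subset_union_right hC)

end FZone

end ZoneZ

end PercRepro
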